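import Summits.Ventures.CertifiedArithmetic.LowPrec.ErrorFreeAdd
import Summits.Ventures.CertifiedArithmetic.LowPrec.EnvelopesE2M1

/-!
# Kernel certificates: the branch-free 2Sum is error-free on every FP4 / FP6 pair under saturation

HONEST FRAMING (venture CertifiedArithmetic / cell `pub-lowprec`): certified error envelopes and
provably optimal rounding/accumulation schemes for low-precision formats under stated cost models;
every table by two implementations; no hardware or vendor claims.

The branch-free 2Sum of Møller–Knuth [KnuthTAOCP2, §4.2.2 Thm B; BoldoMelquiond2017, Thm 5.7
(Algorithm 5.2)]: `s = fl(a + b)`, `a' = fl(s - b)`, `b' = fl(s - a')`, `δa = fl(a - a')`,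
`δb = fl(b - b')`, `t = fl(δa + δb)`; with round-to-nearest and NO OVERFLOW, `t = a + b - s` exactly.
Under IEEE overflow-to-∞ the algorithm is not robust when `a + b` overflows [BoldoGraillatMuller2017].
Here `fl = roundNE φ` SATURATES (OCP MX / `SAT`), and the kernel checks, by exhaustive evaluation over
all ordered pairs of finite data (`MiniFloat.all`, `decide +kernel`), that 2Sum is error-free WITHOUT
EXCEPTION — saturating pairs included — in `E2M1` (`16²` pairs), `E3M2` and `E2M3` (`64²` pairs each):
`twoSum_exact_E2M1/E3M2/E2M3`. (The FP8 formats `E4M3`, `E5M2` pass the same test in the compiled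
evaluator — `254²`/`248²` pairs, 0 failures — which is evidence, not a kernel certificate; the general
theorem for every format is open in this development, cf. `fast2Sum_exact` for the branch variant.)
Contrast (`fast2Sum_noTest_failures_E2M1`): Fast2Sum WITHOUT its magnitude test fails on exactly
`28` of the `256` `E2M1` pairs. The two FP6 certificates evaluate `6 · 4096` roundings in the kernel
and need a raised heartbeat budget (stated per theorem).
-/

namespace Literature.ComputerArithmetic.FloatingPoint

namespace MiniFloat

open Format

/-- 2SUM IS ERROR-FREE ON ALL `E2M1` PAIRS (saturating RNE): with `s = fl(a+b)`, `a' = fl(s-b)`,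
`b' = fl(s-a')`, the value `fl(fl(a-a') + fl(b-b'))` equals `a + b - s`. Kernel-exhaustive over `16²`
ordered pairs. [cite: BoldoMelquiond2017, Thm 5.7 (no-overflow statement); saturation cases new] -/
theorem twoSum_exact_E2M1 (a b : MiniFloat E2M1) :
    (roundNE E2M1 ((roundNE E2M1 (a.toRat - (roundNE E2M1 ((roundNE E2M1 (a.toRat + b.toRat)).toRat
        - b.toRat)).toRat)).toRat
      + (roundNE E2M1 (b.toRat - (roundNE E2M1 ((roundNE E2M1 (a.toRat + b.toRat)).toRat
        - (roundNE E2M1 ((roundNE E2M1 (a.toRat + b.toRat)).toRat - b.toRat)).toRat)).toRat)).toRat)).toRat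
      = a.toRat + b.toRat - (roundNE E2M1 (a.toRat + b.toRat)).toRat := by
  have := forall₂_of_all_all (φ := E2M1) (ψ := E2M1) (P := fun a b =>
    decide ((roundNE E2M1 ((roundNE E2M1 (a.toRat - (roundNE E2M1 ((roundNE E2M1 (a.toRat + b.toRat)).toRat
        - b.toRat)).toRat)).toRat
      + (roundNE E2M1 (b.toRat - (roundNE E2M1 ((roundNE E2M1 (a.toRat + b.toRat)).toRat
        - (roundNE E2M1 ((roundNE E2M1 (a.toRat + b.toRat)).toRat - b.toRat)).toRat)).toRat)).toRat)).toRat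
      = a.toRat + b.toRat - (roundNE E2M1 (a.toRat + b.toRat)).toRat)) (by decide +kernel) a b
  exact of_decide_eq_true this

set_option maxHeartbeats 1600000 in
/-- 2SUM IS ERROR-FREE ON ALL `E3M2` PAIRS (saturating RNE), kernel-exhaustive over `64²` ordered
pairs (six roundings each; heartbeat budget raised for the kernel evaluation).
[cite: BoldoMelquiond2017, Thm 5.7 (no-overflow statement); saturation cases new] -/
theorem twoSum_exact_E3M2 (a b : MiniFloat E3M2) :
    (roundNE E3M2 ((roundNE E3M2 (a.toRat - (roundNE E3M2 ((roundNE E3M2 (a.toRat + b.toRat)).toRat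
        - b.toRat)).toRat)).toRat
      + (roundNE E3M2 (b.toRat - (roundNE E3M2 ((roundNE E3M2 (a.toRat + b.toRat)).toRat
        - (roundNE E3M2 ((roundNE E3M2 (a.toRat + b.toRat)).toRat - b.toRat)).toRat)).toRat)).toRat)).toRat
      = a.toRat + b.toRat - (roundNE E3M2 (a.toRat + b.toRat)).toRat := by
  have := forall₂_of_all_all (φ := E3M2) (ψ := E3M2) (P := fun a b =>
    decide ((roundNE E3M2 ((roundNE E3M2 (a.toRat - (roundNE E3M2 ((roundNE E3M2 (a.toRat + b.toRat)).toRat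
        - b.toRat)).toRat)).toRat
      + (roundNE E3M2 (b.toRat - (roundNE E3M2 ((roundNE E3M2 (a.toRat + b.toRat)).toRat
        - (roundNE E3M2 ((roundNE E3M2 (a.toRat + b.toRat)).toRat - b.toRat)).toRat)).toRat)).toRat)).toRat
      = a.toRat + b.toRat - (roundNE E3M2 (a.toRat + b.toRat)).toRat)) (by decide +kernel) a b
  exact of_decide_eq_true this

set_option maxHeartbeats 1600000 in
/-- 2SUM IS ERROR-FREE ON ALL `E2M3` PAIRS (saturating RNE), kernel-exhaustive over `64²` ordered
pairs (heartbeat budget raised for the kernel evaluation).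
[cite: BoldoMelquiond2017, Thm 5.7 (no-overflow statement); saturation cases new] -/
theorem twoSum_exact_E2M3 (a b : MiniFloat E2M3) :
    (roundNE E2M3 ((roundNE E2M3 (a.toRat - (roundNE E2M3 ((roundNE E2M3 (a.toRat + b.toRat)).toRat
        - b.toRat)).toRat)).toRat
      + (roundNE E2M3 (b.toRat - (roundNE E2M3 ((roundNE E2M3 (a.toRat + b.toRat)).toRat
        - (roundNE E2M3 ((roundNE E2M3 (a.toRat + b.toRat)).toRat - b.toRat)).toRat)).toRat)).toRat)).toRat
      = a.toRat + b.toRat - (roundNE E2M3 (a.toRat + b.toRat)).toRat := by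
  have := forall₂_of_all_all (φ := E2M3) (ψ := E2M3) (P := fun a b =>
    decide ((roundNE E2M3 ((roundNE E2M3 (a.toRat - (roundNE E2M3 ((roundNE E2M3 (a.toRat + b.toRat)).toRat
        - b.toRat)).toRat)).toRat
      + (roundNE E2M3 (b.toRat - (roundNE E2M3 ((roundNE E2M3 (a.toRat + b.toRat)).toRat
        - (roundNE E2M3 ((roundNE E2M3 (a.toRat + b.toRat)).toRat - b.toRat)).toRat)).toRat)).toRat)).toRat
      = a.toRat + b.toRat - (roundNE E2M3 (a.toRat + b.toRat)).toRat)) (by decide +kernel) a b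
  exact of_decide_eq_true this

/-- CONTRAST: Fast2Sum WITHOUT its magnitude test (`s = fl(a+b)`, `z = fl(s-a)`, `t = fl(b-z)` for
arbitrary ordered pairs) fails to return `a + b - s` on exactly `28` of the `256` ordered `E2M1`
pairs (kernel count; with `|b| ≤ |a|` it never fails, `fast2Sum_exact`). [folklore] -/
theorem fast2Sum_noTest_failures_E2M1 :
    Summit.Ventures.CertifiedArithmetic.countPairs E2M1 (fun a b =>
      !decide ((roundNE E2M1 (b.toRat - (roundNE E2M1 ((roundNE E2M1 (a.toRat + b.toRat)).toRat
          - a.toRat)).toRat)).toRat = a.toRat + b.toRat - (roundNE E2M1 (a.toRat + b.toRat)).toRat))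
      = 28 := by
  decide +kernel

end MiniFloat

end Literature.ComputerArithmetic.FloatingPoint
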